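import Literature.NumberTheory.Transcendental.ZudilinCoefficients
import HarnessLib

/-!
# Well-poised symmetry of the partial-fraction coefficients ([Zudilin2004, Lemma 19])

Topic `Literature/NumberTheory/Transcendental`. From the antisymmetry `Rₙ(-37n-k) = -Rₙ(k)`
(`Zudilin2004.R_neg`) we derive, for the coefficients `B n s i` of `ZudilinCoefficients.lean`,

* `Zudilin2004.B_symm` — `B n s (37n - i) = (-1)^{s+1} B n s i` for `i ∈ [2n, 35n]`
  ([Zudilin2004, proof of Lemma 19]: `B_{jk} = (-1)^j B_{j,h₀-k}`; [Fischler2004, §3.3]: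
  `z^{37n} P_j(1/z) = (-1)^{j+1} P_j(z)`), by comparing the germs of `G n (37n-i)` and
  `k ↦ -G n i (-37n-k)` at `-(37n-i)`;
* `Zudilin2004.sum_B_eq_zero_of_even` — `∑_{i=2n}^{35n} B n s i = 0` for even `s` (the
  coefficients of the EVEN zeta values vanish: `A_{j-1} = 0` for odd `j` in [Zudilin2004]).

Everything here is PROVED (no named facts).

## References

* [Zudilin2004] W. Zudilin, *Arithmetic of linear forms involving odd zeta values*, J. Théor.
  Nombres Bordeaux 16 (2004), 251–291, §8, (8.5) and the end of the proof of Lemma 19.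
* [Fischler2004] S. Fischler, Sém. Bourbaki exp. 910, Astérisque 294 (2004), §3.3.
-/

noncomputable section

open Finset Filter Topology Literature.Analysis.Calculus
open scoped Nat

namespace Literature.NumberTheory.Transcendental

namespace Zudilin2004

/-- The reflection `i ↦ 37n - i` preserves the pole set `[2n, 35n]`. [folklore] -/
theorem reflect_mem_poleSet {n i : ℕ} (hi : i ∈ poleSet n) : 37 * n - i ∈ poleSet n := by
  have := mem_Icc.1 hi
  exact mem_Icc.2 ⟨by omega, by omega⟩

/-- Near `-(37n-i)`: `G n (37n-i) k = -G n i (-37n-k)`. [cite: Zudilin2004, §8 (8.5)] -/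
theorem G_reflect_eventuallyEq (n : ℕ) {i : ℕ} (hi : i ∈ poleSet n) :
    G n (37 * n - i) =ᶠ[𝓝 (-((37 * n - i : ℕ) : ℚ))]
      fun k => -G n i (-((37 * n : ℕ) : ℚ) - k) := by
  have hi' := mem_Icc.1 hi
  have hcast : ((37 * n - i : ℕ) : ℚ) = (37 * n : ℕ) - i := by
    rw [Nat.cast_sub (by omega)]
  -- continuity of both sides
  have hc1 : ContinuousAt (G n (37 * n - i)) (-((37 * n - i : ℕ) : ℚ)) :=
    continuousAt_G n (reflect_mem_poleSet hi)
  have hc2 : ContinuousAt (fun k : ℚ => -G n i (-((37 * n : ℕ) : ℚ) - k)) (-((37 * n - i : ℕ) : ℚ)) := by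
    have hG : ContinuousAt (G n i) (-(i : ℚ)) := continuousAt_G n hi
    have haff : ContinuousAt (fun k : ℚ => -((37 * n : ℕ) : ℚ) - k) (-((37 * n - i : ℕ) : ℚ)) :=
      (continuous_const.sub continuous_id).continuousAt
    have hpt : -((37 * n : ℕ) : ℚ) - -((37 * n - i : ℕ) : ℚ) = -(i : ℚ) := by
      rw [hcast]; ring
    exact (ContinuousAt.comp (g := G n i) (by rw [hpt]; exact hG) haff).neg
  refine eventuallyEq_of_nhdsNE hc1 hc2 ?_
  filter_upwards [eventually_good n (37 * n - i)] with k hk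
  have hk1 : k + ((37 * n - i : ℕ) : ℚ) ≠ 0 := hk.1
  -- `-37n-k` is good for the pole set and `(-37n-k) + i ≠ 0`
  have hk2 : -((37 * n : ℕ) : ℚ) - k + i ≠ 0 := by
    intro h; apply hk1; rw [hcast]; linarith
  rw [G_eq n (37 * n - i) hk1, G_eq n i hk2, R_neg, hcast]
  have : (-((37 * n : ℕ) : ℚ) - k + i) = -(k + ((37 * n : ℕ) - i)) := by ring
  rw [this, neg_pow, show ((-1 : ℚ) ^ 10) = 1 by norm_num, one_mul]
  ring

/-- **Well-poised symmetry of the coefficients**: `B n s (37n-i) = (-1)^{s+1} B n s i` for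
`i ∈ [2n, 35n]`, `s ≤ 10` ([Zudilin2004, proof of Lemma 19]: `B_{jk} = (-1)^j B_{j,h₀-k}`).
[cite: Zudilin2004, §8 Lemma 19 (proof)] -/
theorem B_symm (n : ℕ) {i s : ℕ} (hi : i ∈ poleSet n) (hs : s ≤ 10) :
    B n s (37 * n - i) = (-1) ^ (s + 1) * B n s i := by
  have hi' := mem_Icc.1 hi
  unfold B
  rw [divDeriv_congr (G_reflect_eventuallyEq n hi), divDeriv_neg]
  have hfun : (fun k : ℚ => G n i (-((37 * n : ℕ) : ℚ) - k))
      = fun k => (fun t => G n i (-t)) (k + ((37 * n : ℕ) : ℚ)) := by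
    funext k; simp only; congr 1; ring
  rw [hfun, show divDeriv (10 - s) (fun k => (fun t => G n i (-t)) (k + ((37 * n : ℕ) : ℚ)))
      (-((37 * n - i : ℕ) : ℚ)) = divDeriv (10 - s) (fun t => G n i (-t))
      (-((37 * n - i : ℕ) : ℚ) + ((37 * n : ℕ) : ℚ)) from
      divDeriv_comp_add_const (10 - s) (fun t => G n i (-t)) ((37 * n : ℕ) : ℚ) (-((37 * n - i : ℕ) : ℚ)),
    divDeriv_comp_neg]
  have hpt : -(-((37 * n - i : ℕ) : ℚ) + ((37 * n : ℕ) : ℚ)) = -(i : ℚ) := by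
    rw [Nat.cast_sub (by omega)]; ring
  rw [hpt]
  have hsign : -((-1 : ℚ) ^ (10 - s)) = (-1) ^ (s + 1) := by
    rw [neg_eq_neg_one_mul, ← pow_succ', neg_one_pow_eq_pow_mod_two,
      neg_one_pow_eq_pow_mod_two (R := ℚ) (n := s + 1)]
    congr 1
    omega
  rw [← neg_mul, hsign]

/-- **The coefficients of the even zeta values vanish**: `∑_{i=2n}^{35n} B n s i = 0` for even
`s ≤ 10` ([Zudilin2004, proof of Lemma 19]: `A_{j-1} = 0` for odd `j`).
[cite: Zudilin2004, §8 Lemma 19 (proof)] -/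
theorem sum_B_eq_zero_of_even (n : ℕ) {s : ℕ} (hs : s ≤ 10) (heven : Even s) :
    ∑ i ∈ poleSet n, B n s i = 0 := by
  have hrefl : ∑ i ∈ poleSet n, B n s i = ∑ i ∈ poleSet n, B n s (37 * n - i) := by
    refine sum_nbij' (fun i => 37 * n - i) (fun i => 37 * n - i) ?_ ?_ ?_ ?_ ?_
    · intro i hi; exact reflect_mem_poleSet hi
    · intro i hi; exact reflect_mem_poleSet hi
    · intro i hi; have := mem_Icc.1 hi; omega
    · intro i hi; have := mem_Icc.1 hi; omega
    · intro i hi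
      have := mem_Icc.1 hi
      rw [show 37 * n - (37 * n - i) = i by omega]
  have hneg : ∑ i ∈ poleSet n, B n s (37 * n - i) = -∑ i ∈ poleSet n, B n s i := by
    rw [← sum_neg_distrib]
    refine sum_congr rfl fun i hi => ?_
    rw [B_symm n hi hs]
    have : ((-1 : ℚ) ^ (s + 1)) = -1 := by
      rw [pow_succ, heven.neg_one_pow, one_mul]
    rw [this]
    ring
  have h := hrefl.trans hneg
  linarith

end Zudilin2004

end Literature.NumberTheory.Transcendental
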